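import Literature.Uncategorized.Crux
import Literature.Topology.FourManifolds.MappingTorus
import Literature.Topology.FourManifolds.MappingTorusProofs
import Literature.Topology.FourManifolds.MappingTorusFibreTwist
import Literature.Topology.FourManifolds.SurgeredMappingTorus
import Literature.Topology.FourManifolds.CircleSurgery
import Literature.Topology.FourManifolds.CerfGammaFourProofs
import Literature.Topology.FourManifolds.Diffeotopy
import Literature.Topology.FourManifolds.DehnSurgery
import Literature.Topology.FourManifolds.DehnSurgeryTransportProofs
import Literature.Topology.FourManifolds.SliceRibbon
import Literature.Topology.FourManifolds.LeeRasmussen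
import Literature.Barriers.SmoothPoincare4.GluckTwistsDissolve
import Literature.Topology.FourManifolds.ZeroSurgeryHomotopyBallSliceProofs
import Literature.Topology.FourManifolds.ZeroSurgeryHomotopyBallSliceHolds
import Literature.Topology.FourManifolds.HomotopyBallSliceProofs
import HarnessLib

/-!
# drefute calibration of the bet `stub_kernelWitness` (line `monodromy-kernel-engine`, crux 0366)

`KernelWitness` below is the body of `stub_kernelWitness` verbatim; `SectorCrux` is the crux
`Literature.Uncategorized.Crux` restricted to the sector {`K` ribbon, the common `0`-surgery `Y` is a smooth
mapping torus of a self-diffeomorphism of a closed connected surface} — i.e. {`K` ribbon and fibred} by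
Gabai — with NO monodromy relation. We prove, kernel-checked:

* `kernelWitness_iff_sectorCrux : KernelWitness ↔ SectorCrux` — the stub is EXACTLY the sector crux: the
  conjugate-isotopic-monodromy clause buys nothing and costs nothing (⇒ uses the two glue stubs, proved
  here as `isMappingTorusOf_of_isDiffeotopic` / `isMappingTorusOf_conj`, + uniqueness of smooth mapping tori
  + transport of `IsIntegralSurgery`; ⇐ takes `Y' = Y`, `φ' = φ`, `g = refl`);
* `crux_of_sectorCrux : SectorCrux → Crux` (forget ribbon ⇒ slice and the fibration);
* `not_kernelWitness_of_mmsw911 : MMSW2023Question911Knot → ¬ KernelWitness` — the stub's kill switch is the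
  (fibred-ribbon sector of the) OPEN MMSW 2023 Question 9.11, nothing weaker is catalogued.

Refuter verdict: `stub_kernelWitness` SURVIVED — correctly typed, junk-free, of open-problem strength
(equivalent to the crux on its sector; implies an exotic homotopy 4-ball).
-/

noncomputable section

set_option linter.dupNamespace false
set_option linter.unusedVariables false

open scoped Manifold ContDiff Topology
open Set Function
open Literature.Topology.FourManifolds Literature.Uncategorized Literature.Barriers.SmoothPoincare4

namespace Summit.SmoothPoincare4.SmoothPoincare4.Cruxes.ZseCruxRasmussen.MonodromyKernelEngine.Drefute

/-- Local notation: `𝔼 n = ℝⁿ`. -/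
local notation "𝔼 " n:arg => EuclideanSpace ℝ (Fin n)

/-! ## The two glue stubs, proved (generic fibre and models) -/

/-- Isotopy invariance of smooth mapping tori (= `stub_mappingTorus_isotopy`). [folklore] -/
theorem isMappingTorusOf_of_isDiffeotopic
    {E H : Type*} [NormedAddCommGroup E] [NormedSpace ℝ E] [TopologicalSpace H]
    {I : ModelWithCorners ℝ E H}
    {ET HT : Type*} [NormedAddCommGroup ET] [NormedSpace ℝ ET] [TopologicalSpace HT]
    {IT : ModelWithCorners ℝ ET HT}
    {M : Type*} [TopologicalSpace M] [ChartedSpace H M] [IsManifold I ∞ M]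
    {T : Type*} [TopologicalSpace T] [ChartedSpace HT T] [IsManifold IT ∞ T]
    (φ ψ : M ≃ₘ⟮I, I⟯ M) (hD : Diffeomorph.IsDiffeotopic φ ψ) (h : IsMappingTorusOf IT T φ) :
    IsMappingTorusOf IT T ψ := by
  obtain ⟨D, hD⟩ := hD
  obtain ⟨jA, jB, hW⟩ := h
  have hD1 : ∀ y, D.toFun 1 y = ψ (φ.symm y) := fun y => by
    have := congrArg (fun χ : M ≃ₘ⟮I, I⟯ M => χ y) hD
    simpa using this
  have hDinv1 : ∀ x, D.inv.toFun 1 x = φ (ψ.symm x) := fun x => by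
    rw [Diffeotopy.inv_toFun]
    have h1 : D.toFun 1 (φ (ψ.symm x)) = x := by
      rw [hD1, Diffeomorph.symm_apply_apply, Diffeomorph.apply_symm_apply]
    conv_lhs => rw [← h1]
    rw [Diffeotopy.invFun_toFun]
  exact (IsOpenGluingWith.fibreTwist_of_eq φ D.inv hW ψ hDinv1).isOpenGluing

/-- Conjugation invariance of smooth mapping tori (= `stub_mappingTorus_conj`). [folklore] -/
theorem isMappingTorusOf_conj
    {E H : Type*} [NormedAddCommGroup E] [NormedSpace ℝ E] [TopologicalSpace H]
    {I : ModelWithCorners ℝ E H}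
    {ET HT : Type*} [NormedAddCommGroup ET] [NormedSpace ℝ ET] [TopologicalSpace HT]
    {IT : ModelWithCorners ℝ ET HT}
    {M : Type*} [TopologicalSpace M] [ChartedSpace H M] [IsManifold I ∞ M]
    {T : Type*} [TopologicalSpace T] [ChartedSpace HT T] [IsManifold IT ∞ T]
    (φ g : M ≃ₘ⟮I, I⟯ M) (h : IsMappingTorusOf IT T φ) :
    IsMappingTorusOf IT T ((g.trans φ).trans g.symm) := by
  obtain ⟨jA, jB, hA, hAo, hB, hBo, hU, hR⟩ := h
  have h1 : Function.Surjective
      (Prod.map g (id : ↥mappingTorusPieceOne → ↥mappingTorusPieceOne)) :=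
    (EquivLike.surjective g).prodMap Function.surjective_id
  have h2 : Function.Surjective
      (Prod.map g (id : ↥mappingTorusPieceTwo → ↥mappingTorusPieceTwo)) :=
    (EquivLike.surjective g).prodMap Function.surjective_id
  have hψ : ∀ x, g (((g.trans φ).trans g.symm) x) = φ (g x) := fun x => by simp
  refine ⟨jA ∘ Prod.map g id, jB ∘ Prod.map g id, ?_, ?_, ?_, ?_, ?_, fun a b => ?_⟩
  · have := hA.comp_diffeomorph (g.prodCongr (Diffeomorph.refl 𝓘(ℝ, ℝ) ↥mappingTorusPieceOne ∞))
    simpa only [Diffeomorph.coe_prodCongr, Diffeomorph.coe_refl] using this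
  · rwa [h1.range_comp]
  · have := hB.comp_diffeomorph (g.prodCongr (Diffeomorph.refl 𝓘(ℝ, ℝ) ↥mappingTorusPieceTwo ∞))
    simpa only [Diffeomorph.coe_prodCongr, Diffeomorph.coe_refl] using this
  · rwa [h2.range_comp]
  · rwa [h1.range_comp, h2.range_comp]
  · rw [Function.comp_apply, Function.comp_apply, hR]
    exact mappingTorusRel_prodMap_iff' (EquivLike.injective g) hψ a b

/-! ## The bet and the sector crux -/

/-- The body of `stub_kernelWitness`, verbatim. -/
def KernelWitness : Prop :=
    ∃ (K K' : Knot)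
      (F : Type) (_ : TopologicalSpace F) (_ : T2Space F) (_ : SecondCountableTopology F)
      (_ : ChartedSpace (𝔼 2) F) (_ : IsManifold (𝓡 2) ∞ F) (_ : CompactSpace F) (_ : ConnectedSpace F)
      (φ φ' g : F ≃ₘ⟮𝓡 2, 𝓡 2⟯ F)
      (Y : Type) (_ : TopologicalSpace Y) (_ : T2Space Y) (_ : SecondCountableTopology Y)
      (_ : ChartedSpace (𝔼 3) Y) (_ : IsManifold (𝓡 3) ∞ Y)
      (Y' : Type) (_ : TopologicalSpace Y') (_ : T2Space Y') (_ : SecondCountableTopology Y')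
      (_ : ChartedSpace (𝔼 3) Y') (_ : IsManifold (𝓡 3) ∞ Y')
      (s : ℤ),
      K.IsRibbon ∧
      IsIntegralSurgery (𝓡 3) Y K 0 ∧ IsMappingTorusOf (𝓡 3) Y φ ∧
      IsIntegralSurgery (𝓡 3) Y' K' 0 ∧ IsMappingTorusOf (𝓡 3) Y' φ' ∧
      Diffeomorph.IsDiffeotopic ((g.trans φ).trans g.symm) φ' ∧
      K'.HasRasmussenInvariant s ∧ s ≠ 0

/-- The crux on the sector {`K` ribbon, the common `0`-surgery fibres over the circle}: no monodromy
relation at all. -/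
def SectorCrux : Prop :=
    ∃ (K K' : Knot)
      (F : Type) (_ : TopologicalSpace F) (_ : T2Space F) (_ : SecondCountableTopology F)
      (_ : ChartedSpace (𝔼 2) F) (_ : IsManifold (𝓡 2) ∞ F) (_ : CompactSpace F) (_ : ConnectedSpace F)
      (φ : F ≃ₘ⟮𝓡 2, 𝓡 2⟯ F)
      (Y : Type) (_ : TopologicalSpace Y) (_ : T2Space Y) (_ : SecondCountableTopology Y)
      (_ : ChartedSpace (𝔼 3) Y) (_ : IsManifold (𝓡 3) ∞ Y)
      (s : ℤ),
      K.IsRibbon ∧ IsIntegralSurgery (𝓡 3) Y K 0 ∧ IsMappingTorusOf (𝓡 3) Y φ ∧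
      IsIntegralSurgery (𝓡 3) Y K' 0 ∧ K'.HasRasmussenInvariant s ∧ s ≠ 0

/-- **Calibration: the bet is exactly the sector crux.** [folklore] -/
theorem kernelWitness_iff_sectorCrux : KernelWitness ↔ SectorCrux := by
  constructor
  · rintro ⟨K, K', F, _, _, _, _, _, _, _, φ, φ', g, Y, _, _, _, _, _, Y', _, _, _, _, _, s,
      hrib, hKY, hYφ, hK'Y', hY'φ', hconj, hs, hs0⟩
    have h1 : IsMappingTorusOf (𝓡 3) Y ((g.trans φ).trans g.symm) := isMappingTorusOf_conj φ g hYφ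
    have h2 : IsMappingTorusOf (𝓡 3) Y φ' := isMappingTorusOf_of_isDiffeotopic _ _ hconj h1
    obtain ⟨e⟩ := nonempty_diffeomorph_of_isMappingTorusOf_holds (T := Y') (T' := Y) hY'φ' h2
    exact ⟨K, K', F, ‹_›, ‹_›, ‹_›, ‹_›, ‹_›, ‹_›, ‹_›, φ, Y, ‹_›, ‹_›, ‹_›, ‹_›, ‹_›, s, hrib, hKY, hYφ,
      hK'Y'.of_diffeomorph_of_boundaryless e, hs, hs0⟩
  · rintro ⟨K, K', F, _, _, _, _, _, _, _, φ, Y, _, _, _, _, _, s, hrib, hKY, hYφ, hK'Y, hs, hs0⟩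
    refine ⟨K, K', F, ‹_›, ‹_›, ‹_›, ‹_›, ‹_›, ‹_›, ‹_›, φ, φ, Diffeomorph.refl (𝓡 2) F ∞,
      Y, ‹_›, ‹_›, ‹_›, ‹_›, ‹_›, Y, ‹_›, ‹_›, ‹_›, ‹_›, ‹_›, s, hrib, hKY, hYφ, hK'Y, hYφ, ?_, hs, hs0⟩
    have : ((Diffeomorph.refl (𝓡 2) F ∞).trans φ).trans (Diffeomorph.refl (𝓡 2) F ∞).symm = φ := by
      ext x; simp
    rw [this]
    exact Diffeomorph.IsDiffeotopic.refl φ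

/-- The sector crux implies the crux (ribbon ⇒ slice, forget the fibration). [folklore] -/
theorem crux_of_sectorCrux (h : SectorCrux) : Crux := by
  obtain ⟨K, K', F, _, _, _, _, _, _, _, φ, Y, _, _, _, _, _, s, hrib, hKY, -, hK'Y, hs, hs0⟩ := h
  exact ⟨K, K', Y, _, _, s, hKY, hK'Y, hrib.isSmoothlySlice, hs, hs0⟩

/-- Hence the bet implies the crux (this is the line's composition, re-derived). [folklore] -/
theorem crux_of_kernelWitness (h : KernelWitness) : Crux :=
  crux_of_sectorCrux (kernelWitness_iff_sectorCrux.1 h)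

/-- **Kill switch of the bet = MMSW 2023 Question 9.11 (knots)**, OPEN: a positive answer refutes
`stub_kernelWitness` (through Manolescu–Piccirillo Lemma 3.3, PROVED in the tree, and the FGMW lemma).
Nothing weaker is catalogued; in particular no vanishing theorem for `s` on `0`-friends of fibred ribbon
knots is known. [cite: ManolescuMarengonSarkarWillis2023, Question 9.11] -/
theorem not_kernelWitness_of_mmsw911 (h : MMSW2023Question911Knot) : ¬ KernelWitness := by
  intro hk
  obtain ⟨K, K', Y, _, _, s, hK, hK', hsl, hs, hs0⟩ := crux_of_kernelWitness hk
  have hball : K'.IsHomotopyBallSlice :=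
    Knot.ManolescuPiccirillo2023_lemma33_sphere_holds K K' Y
      ((FramedLink.isSurgery_single_iff K 0).2 hK) ((FramedLink.isSurgery_single_iff K' 0).2 hK') hsl
  exact (not_fgmwRasmussenStrategy_iff_question.2 h) ⟨K', hball, s, hs, hs0⟩

/-! ## Hypothesis mutation: the minimal form of the bet the composition actually consumes -/

/-- **The bet with every binder / conjunct the composition does not consume removed**: no
`CompactSpace F`, no `ConnectedSpace F`, no `T2Space`/`SecondCountableTopology` on `Y`, `Y'`, and
`K.IsSmoothlySlice` in place of `K.IsRibbon`. (`T2Space F`, `SecondCountableTopology F`, the two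
`IsManifold` instances and both mapping-torus clauses ARE consumed: uniqueness of smooth mapping tori.) -/
def KernelWitnessMin : Prop :=
    ∃ (K K' : Knot)
      (F : Type) (_ : TopologicalSpace F) (_ : T2Space F) (_ : SecondCountableTopology F)
      (_ : ChartedSpace (𝔼 2) F) (_ : IsManifold (𝓡 2) ∞ F)
      (φ φ' g : F ≃ₘ⟮𝓡 2, 𝓡 2⟯ F)
      (Y : Type) (_ : TopologicalSpace Y) (_ : ChartedSpace (𝔼 3) Y) (_ : IsManifold (𝓡 3) ∞ Y)
      (Y' : Type) (_ : TopologicalSpace Y') (_ : ChartedSpace (𝔼 3) Y') (_ : IsManifold (𝓡 3) ∞ Y')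
      (s : ℤ),
      K.IsSmoothlySlice ∧
      IsIntegralSurgery (𝓡 3) Y K 0 ∧ IsMappingTorusOf (𝓡 3) Y φ ∧
      IsIntegralSurgery (𝓡 3) Y' K' 0 ∧ IsMappingTorusOf (𝓡 3) Y' φ' ∧
      Diffeomorph.IsDiffeotopic ((g.trans φ).trans g.symm) φ' ∧
      K'.HasRasmussenInvariant s ∧ s ≠ 0

/-- The stub implies its minimal form (forget the decoration, ribbon ⇒ slice). [folklore] -/
theorem kernelWitnessMin_of_kernelWitness (h : KernelWitness) : KernelWitnessMin := by
  obtain ⟨K, K', F, _, _, _, _, _, _, _, φ, φ', g, Y, _, _, _, _, _, Y', _, _, _, _, _, s,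
    hrib, hKY, hYφ, hK'Y', hY'φ', hconj, hs, hs0⟩ := h
  exact ⟨K, K', F, ‹_›, ‹_›, ‹_›, ‹_›, ‹_›, φ, φ', g, Y, ‹_›, ‹_›, ‹_›, Y', ‹_›, ‹_›, ‹_›, s,
    hrib.isSmoothlySlice, hKY, hYφ, hK'Y', hY'φ', hconj, hs, hs0⟩

/-- **The minimal form already yields the crux** (same composition: conj + isotopy + uniqueness +
transport), so `IsRibbon`, compactness/connectedness of the fibre and the separation/countability
axioms on `Y`, `Y'` are not load-bearing for the line — information for the lead (the stub may be
weakened to `KernelWitnessMin` without touching `ZseCruxRasmussen_of`). [folklore] -/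
theorem crux_of_kernelWitnessMin (h : KernelWitnessMin) : Crux := by
  obtain ⟨K, K', F, _, _, _, _, _, φ, φ', g, Y, _, _, _, Y', _, _, _, s,
    hsl, hKY, hYφ, hK'Y', hY'φ', hconj, hs, hs0⟩ := h
  have h1 : IsMappingTorusOf (𝓡 3) Y ((g.trans φ).trans g.symm) := isMappingTorusOf_conj φ g hYφ
  have h2 : IsMappingTorusOf (𝓡 3) Y φ' := isMappingTorusOf_of_isDiffeotopic _ _ hconj h1
  obtain ⟨e⟩ := nonempty_diffeomorph_of_isMappingTorusOf_holds (T := Y') (T' := Y) hY'φ' h2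
  exact ⟨K, K', Y, _, _, s, hKY, hK'Y'.of_diffeomorph_of_boundaryless e, hsl, hs, hs0⟩

end Summit.SmoothPoincare4.SmoothPoincare4.Cruxes.ZseCruxRasmussen.MonodromyKernelEngine.Drefute

end
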